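import Mathlib
import Summits.Ventures.PercRepro.PuncturedLYMPeel
import Summits.Ventures.PercRepro.PuncturedLYMTypeLiftFamily

/-!
# PercRepro — THE PEELING STEP FOR THE PUNCTURED FAMILIES: (SP)_a ON `C ∪ W` FROM (SP)_{a·A(s)} ON `W`
(p10, gen 42)

`rowsOf S l 𝒞` = the `l`-subsets of the ground set `S` containing no member of the family `𝒞`; `colMass 𝒞 a Y` = `1` if
`Y` contains a member, `a` otherwise.  (SP)_a on `(S, l, 𝒞)` is a flow of `(S, l, rowsOf S l 𝒞)` with constant row sums and
column sums `colMass 𝒞 a` (paper proofs/P10-PEEL-g42.md §0).  THE PEELING STEP (`hasFlow_peel_sp`): peel a member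
`C ∈ 𝒞` of size `m`, `W = S ∖ C`, `𝒞' = 𝒞 ∖ {C}`; given numbers `A s ∈ [0,1]` with `A 0 = 1`, flows of (SP)_{a·A s} on
`(W, l − s, 𝒞')` with row sums `R' s` for every `s ≤ l`, `s < m`, and the row equations
`(m − s)·a·(1 − A (s+1))/(s+1) + R' s = R` (`s + 1 < m`) and `1/m + R' (m−1) = R`, the composed weight of
`PuncturedLYMPeel` is a flow of (SP)_a on `(S, l, 𝒞)` with row sums `R` — the `A s` being the solutions of the
triangular system of paper §1, which any instance provides as explicit rationals.  Hypotheses: the members pairwise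
disjoint, all of size `m > 0`, `l + 1 < 2m` (no column contains two members), `0 ≤ a`.  `rowsOf_univ_eq_punctured`
bridges to the tree's `punctured` of an indexed family.  Nothing here asserts (SP).
-/

namespace PercRepro.PuncturedLYM.Split.Peel

open Finset

variable {α : Type} [DecidableEq α]

/-- The rows of (SP) on the ground set `S` at level `l` for the member family `𝒞`: the `l`-subsets of `S` containing
no member. -/
def rowsOf (S : Finset α) (l : ℕ) (𝒞 : Finset (Finset α)) : Finset (Finset α) :=
  (S.powersetCard l).filter (fun X => ∀ C ∈ 𝒞, ¬ C ⊆ X)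

/-- The column masses of (SP)_a: `1` on the columns containing a member, `a` on the free columns. -/
def colMass (𝒞 : Finset (Finset α)) (a : ℚ) (Y : Finset α) : ℚ := if ∃ C ∈ 𝒞, C ⊆ Y then 1 else a

/-- Membership in the rows. -/
theorem mem_rowsOf {S X : Finset α} {l : ℕ} {𝒞 : Finset (Finset α)} :
    X ∈ rowsOf S l 𝒞 ↔ X ⊆ S ∧ X.card = l ∧ ∀ C ∈ 𝒞, ¬ C ⊆ X := by
  simp only [rowsOf, mem_filter, mem_powersetCard, and_assoc]

/-- On the whole type the rows are the tree's punctured level of the union of the up-levels of an indexed family. -/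
theorem rowsOf_univ_eq_punctured [Fintype α] {k l : ℕ} (C : Fin k → Finset α) :
    rowsOf univ l ((univ : Finset (Fin k)).image C)
      = punctured l ((univ : Finset (Fin k)).biUnion (fun i => upLevel l (C i))) := by
  ext X
  rw [mem_rowsOf, TypeLift.mem_punctured_family]
  simp only [subset_univ, true_and, mem_image, mem_univ, true_and, forall_exists_index]
  constructor
  · rintro ⟨hXc, hX⟩
    exact ⟨hXc, fun i => hX (C i) i rfl⟩
  · rintro ⟨hXc, hX⟩
    refine ⟨hXc, ?_⟩
    rintro C' i rfl
    exact hX i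

/-- **THE PEELING STEP FOR (SP)_a.** See the module docstring. -/
theorem hasFlow_peel_sp {S : Finset α} {𝒞 : Finset (Finset α)} {C : Finset α} (hC : C ∈ 𝒞) (hCS : C ⊆ S)
    (h𝒞S : ∀ C' ∈ 𝒞, C' ⊆ S) {m : ℕ} (hm : 0 < m) (hcard : ∀ C' ∈ 𝒞, C'.card = m)
    (hdisj : ∀ C' ∈ 𝒞, C' ≠ C → Disjoint C C') {l : ℕ} (hl : l + 1 < 2 * m)
    {a : ℚ} (ha : 0 ≤ a) {A : ℕ → ℚ} (hA0 : A 0 = 1) (hA : ∀ s, 0 ≤ A s ∧ A s ≤ 1)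
    (hAtop : l + 1 < m → A (l + 1) = 0) {R : ℚ} {R' : ℕ → ℚ}
    (hinner : ∀ s, s ≤ l → s < m →
      HasFlow (S \ C) (l - s) (rowsOf (S \ C) (l - s) (𝒞.erase C)) (fun _ => R' s) (colMass (𝒞.erase C) (a * A s)))
    (heq : ∀ s, s + 1 < m → s ≤ l → ((m : ℚ) - s) * a * (1 - A (s + 1)) / (s + 1) + R' s = R)
    (heq' : m - 1 ≤ l → 1 / (m : ℚ) + R' (m - 1) = R) :
    HasFlow S l (rowsOf S l 𝒞) (fun _ => R) (colMass 𝒞 a) := by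
  set W := S \ C with hW
  have hCW : Disjoint C W := disjoint_sdiff
  have hS : C ∪ W = S := union_sdiff_of_subset hCS
  have hmC : C.card = m := hcard C hC
  -- the inner members lie in `W`
  have hsubW : ∀ C' ∈ 𝒞.erase C, C' ⊆ W := by
    intro C' hC'
    obtain ⟨hne, hC'𝒞⟩ := mem_erase.1 hC'
    exact subset_sdiff.2 ⟨h𝒞S C' hC'𝒞, (hdisj C' hC'𝒞 hne).symm⟩
  -- a `(l+1)`-set containing `C` contains no other member
  have htwo : ∀ Y : Finset α, Y.card = l + 1 → C ⊆ Y → ∀ C' ∈ 𝒞.erase C, ¬ C' ⊆ Y := by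
    intro Y hYc hCY C' hC' hC'Y
    obtain ⟨hne, hC'𝒞⟩ := mem_erase.1 hC'
    have hd : Disjoint C C' := hdisj C' hC'𝒞 hne
    have h := card_le_card (union_subset hCY hC'Y)
    rw [card_union_of_disjoint hd, hmC, hcard C' hC'𝒞, hYc] at h
    omega
  -- the inner flows, chosen
  choose w' hw' using fun s (hs : s ≤ l ∧ s < m) => hinner s hs.1 hs.2
  let w'' : ℕ → Finset α → Finset α → ℚ := fun s =>
    if hs : s ≤ l ∧ s < m then w' s hs else fun _ _ => 0
  let P' : ℕ → Finset (Finset α) := fun t => rowsOf W t (𝒞.erase C)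
  let g : ℕ → Finset α → ℚ := fun t Y' =>
    if t = m then 1 / (m : ℚ) else if (∀ C' ∈ 𝒞.erase C, ¬ C' ⊆ Y') then a * (1 - A t) / t else 0
  have hP' : ∀ t, P' t ⊆ W.powersetCard t := fun t X hX => mem_powersetCard.2 ⟨(mem_rowsOf.1 hX).1, (mem_rowsOf.1 hX).2.1⟩
  have hw''nn : ∀ s X Y, 0 ≤ w'' s X Y := by
    intro s X Y
    simp only [w'']
    split_ifs with hs
    · exact (hw' s hs).nonneg X Y
    · exact le_refl 0
  have hflow : ∀ s, s ≤ l → s < C.card →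
      IsFlow W (l - s) (P' (l - s)) (fun _ => R' s) (colMass (𝒞.erase C) (a * A s)) (w'' s) := by
    intro s hs1 hs2
    rw [hmC] at hs2
    have : w'' s = w' s ⟨hs1, hs2⟩ := by simp only [w'', dif_pos (And.intro hs1 hs2)]
    rw [this]
    exact hw' s ⟨hs1, hs2⟩
  have hg : ∀ t Y, 0 ≤ g t Y := by
    intro t Y
    simp only [g]
    split_ifs
    · positivity
    · have := (hA t).2
      apply div_nonneg (mul_nonneg ha (by linarith)) (by positivity)
    · exact le_refl 0
  have hpeel := isFlow_peel hCW hP' hw''nn hflow hg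
  -- the stage rows are the rows of (SP) on `S`
  have hrows : stageRows C W l P' = rowsOf S l 𝒞 := by
    ext X
    constructor
    · intro h
      obtain ⟨hXS, hXc, hCX, hXW⟩ := mem_stageRows.1 h
      rw [hS] at hXS
      rw [mem_rowsOf]
      refine ⟨hXS, hXc, ?_⟩
      intro C' hC' hC'X
      by_cases hne : C' = C
      · exact hCX (hne ▸ hC'X)
      · have hmem : C' ∈ 𝒞.erase C := mem_erase.2 ⟨hne, hC'⟩
        exact (mem_rowsOf.1 hXW).2.2 C' hmem (subset_inter hC'X (hsubW C' hmem))
    · intro h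
      obtain ⟨hXS, hXc, hX⟩ := mem_rowsOf.1 h
      rw [mem_stageRows, hS]
      refine ⟨hXS, hXc, hX C hC, ?_⟩
      show X ∩ W ∈ rowsOf W (l - (X ∩ C).card) (𝒞.erase C)
      rw [mem_rowsOf]
      refine ⟨inter_subset_right, ?_, ?_⟩
      · have hsplit : X = X ∩ C ∪ X ∩ W := by rw [← inter_union_distrib_left, hS, inter_eq_left.2 hXS]
        have hd : Disjoint (X ∩ C) (X ∩ W) := hCW.mono inter_subset_right inter_subset_right
        have := card_union_of_disjoint hd
        rw [← hsplit, hXc] at this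
        omega
      · intro C' hC' hC'X
        exact hX C' (mem_of_mem_erase hC') (hC'X.trans inter_subset_left)
  rw [hrows, hS] at hpeel
  refine ⟨peelWeight C W g w'', hpeel.nonneg, ?_, ?_⟩
  · -- the row sums
    intro X hX
    rw [hpeel.row X hX]
    obtain ⟨hXS, hXc, hXfree⟩ := mem_rowsOf.1 hX
    have hsC : (X ∩ C).card < m := by
      rw [← hmC]
      by_contra h
      have h' : C.card ≤ (X ∩ C).card := not_lt.1 h
      have : X ∩ C = C := eq_of_subset_of_card_le inter_subset_right h'
      exact hXfree C hC (this ▸ inter_subset_left)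
    have hsl : (X ∩ C).card ≤ l := by rw [← hXc]; exact card_le_card inter_subset_left
    have hXWfree : ∀ C' ∈ 𝒞.erase C, ¬ C' ⊆ X ∩ W := fun C' hC' h =>
      hXfree C' (mem_of_mem_erase hC') (h.trans inter_subset_left)
    by_cases hlast : (X ∩ C).card + 1 = m
    · -- the row class `s = m − 1`: the member column of `C`
      have hg1 : g ((X ∩ C).card + 1) (X ∩ W) = 1 / (m : ℚ) := by simp only [g, if_pos hlast]
      have hm1 : (X ∩ C).card = m - 1 := by omega
      rw [hg1, hm1, hmC]
      have h1 : ((m : ℚ) - ((m - 1 : ℕ) : ℚ)) = 1 := by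
        rw [Nat.cast_sub hm]; push_cast; ring
      rw [h1, one_mul]
      exact heq' (by omega)
    · have hlt : (X ∩ C).card + 1 < m := by omega
      have hg1 : g ((X ∩ C).card + 1) (X ∩ W) = a * (1 - A ((X ∩ C).card + 1)) / ((X ∩ C).card + 1) := by
        simp only [g, if_neg (by omega : ¬ (X ∩ C).card + 1 = m), if_pos hXWfree]
        push_cast; rfl
      rw [hg1, hmC]
      have := heq (X ∩ C).card hlt hsl
      rw [← this]; ring
  · -- the column sums
    intro Y hY
    rw [hpeel.col Y hY]
    obtain ⟨hYS, hYc⟩ := mem_cols.1 hY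
    have hsplit : Y = Y ∩ C ∪ Y ∩ W := by rw [← inter_union_distrib_left, hS, inter_eq_left.2 hYS]
    have hd : Disjoint (Y ∩ C) (Y ∩ W) := hCW.mono inter_subset_right inter_subset_right
    have hsum : (Y ∩ C).card + (Y ∩ W).card = l + 1 := by
      rw [← card_union_of_disjoint hd, ← hsplit, hYc]
    have htC : (Y ∩ C).card ≤ m := by rw [← hmC]; exact card_le_card inter_subset_right
    -- the inner part is a column of the inner instance or empty
    by_cases hCY : C ⊆ Y
    · -- a member column of `C`
      have ht : (Y ∩ C).card = m := by rw [inter_eq_right.2 hCY, hmC]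
      have hfreeW : Y ∩ W ∈ P' (l + 1 - (Y ∩ C).card) := by
        rw [mem_rowsOf]
        refine ⟨inter_subset_right, by omega, ?_⟩
        intro C' hC' hC'Y
        exact htwo Y hYc hCY C' hC' (hC'Y.trans inter_subset_left)
      have hg1 : g (Y ∩ C).card (Y ∩ W) = 1 / (m : ℚ) := by simp only [g, if_pos ht]
      rw [if_pos hfreeW, hg1, if_neg (by omega : ¬ ((Y ∩ C).card < C.card ∧ (Y ∩ C).card ≤ l)), ht]
      have hmem : ∃ C' ∈ 𝒞, C' ⊆ Y := ⟨C, hC, hCY⟩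
      simp only [colMass]
      rw [if_pos hmem]
      have hm0 : (m : ℚ) ≠ 0 := by positivity
      field_simp
      ring
    · have htlt : (Y ∩ C).card < m := by
        rw [← hmC]
        by_contra h
        have h' : C.card ≤ (Y ∩ C).card := not_lt.1 h
        have : Y ∩ C = C := eq_of_subset_of_card_le inter_subset_right h'
        exact hCY (this ▸ inter_subset_left)
      have hgt : g (Y ∩ C).card (Y ∩ W)
          = if (∀ C' ∈ 𝒞.erase C, ¬ C' ⊆ Y ∩ W) then a * (1 - A (Y ∩ C).card) / (Y ∩ C).card else 0 := by
        simp only [g, if_neg (by omega : ¬ (Y ∩ C).card = m)]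
      by_cases hfree : ∀ C' ∈ 𝒞.erase C, ¬ C' ⊆ Y ∩ W
      · -- a free column
        have hnomem : ¬ ∃ C' ∈ 𝒞, C' ⊆ Y := by
          rintro ⟨C', hC', hC'Y⟩
          by_cases hne : C' = C
          · exact hCY (hne ▸ hC'Y)
          · have hmem : C' ∈ 𝒞.erase C := mem_erase.2 ⟨hne, hC'⟩
            exact hfree C' hmem (subset_inter hC'Y (hsubW C' hmem))
        have hcolY : colMass 𝒞 a Y = a := by simp only [colMass, if_neg hnomem]
        rw [hcolY, hgt, if_pos hfree]
        by_cases htl : (Y ∩ C).card ≤ l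
        · have hYW : Y ∩ W ∈ P' (l + 1 - (Y ∩ C).card) := by
            rw [mem_rowsOf]; exact ⟨inter_subset_right, by omega, hfree⟩
          have hboth : (Y ∩ C).card < C.card ∧ (Y ∩ C).card ≤ l := ⟨by omega, htl⟩
          rw [if_pos hYW, if_pos hboth]
          have hcol' : colMass (𝒞.erase C) (a * A (Y ∩ C).card) (Y ∩ W) = a * A (Y ∩ C).card := by
            simp only [colMass]
            rw [if_neg]
            rintro ⟨C', hC', hC'Y⟩
            exact hfree C' hC' hC'Y
          rw [hcol']
          by_cases ht0 : (Y ∩ C).card = 0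
          · rw [ht0, hA0, Nat.cast_zero, zero_mul, zero_add, mul_one]
          · have hpos : (0 : ℚ) < (Y ∩ C).card := by exact_mod_cast Nat.pos_of_ne_zero ht0
            have key : ((Y ∩ C).card : ℚ) * (a * (1 - A (Y ∩ C).card) / (Y ∩ C).card)
                = a * (1 - A (Y ∩ C).card) := by
              rw [mul_div_assoc']
              exact mul_div_cancel_left₀ _ hpos.ne'
            rw [key]
            ring
        · -- the column lies inside `C`: `t = l + 1 < m`, the inner part is empty
          have ht : (Y ∩ C).card = l + 1 := by omega
          have hYW : Y ∩ W ∈ P' (l + 1 - (Y ∩ C).card) := by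
            rw [mem_rowsOf]
            refine ⟨inter_subset_right, by omega, hfree⟩
          rw [if_pos hYW, if_neg (by omega : ¬ ((Y ∩ C).card < C.card ∧ (Y ∩ C).card ≤ l))]
          rw [ht, hAtop (by omega)]
          have hpos : (0 : ℚ) < ((l + 1 : ℕ) : ℚ) := by positivity
          field_simp
          ring
      · -- a column containing an inner member
        obtain ⟨C', hC', hC'Y⟩ : ∃ C' ∈ 𝒞.erase C, C' ⊆ Y ∩ W := by
          by_contra h
          exact hfree (fun C' hC' hC'Y => h ⟨C', hC', hC'Y⟩)
        have hmem : ∃ C'' ∈ 𝒞, C'' ⊆ Y := ⟨C', mem_of_mem_erase hC', hC'Y.trans inter_subset_left⟩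
        have hcolY : colMass 𝒞 a Y = 1 := by simp only [colMass, if_pos hmem]
        have hnot : Y ∩ W ∉ P' (l + 1 - (Y ∩ C).card) := by
          intro h
          exact (mem_rowsOf.1 h).2.2 C' hC' hC'Y
        have htl : (Y ∩ C).card ≤ l := by
          by_contra h
          have hempty : Y ∩ W = ∅ := by rw [← card_eq_zero]; omega
          have hC'ne : C'.card = m := hcard C' (mem_of_mem_erase hC')
          rw [hempty, subset_empty] at hC'Y
          rw [hC'Y, card_empty] at hC'ne
          omega
        have hboth : (Y ∩ C).card < C.card ∧ (Y ∩ C).card ≤ l := ⟨by omega, htl⟩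
        have hmem' : ∃ C'' ∈ 𝒞.erase C, C'' ⊆ Y ∩ W := ⟨C', hC', hC'Y⟩
        rw [hcolY, if_neg hnot, if_pos hboth]
        simp only [colMass, zero_add]
        rw [if_pos hmem']

end PercRepro.PuncturedLYM.Split.Peel
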